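import Summits.ABC.ABC.Theses.AntisymmetricTwoTorsion
import HarnessLib

/-!
# Route `AntisymmetricTwoTorsion` — item `Assembly` (stmt-ABC-23399)

`Assembly := RadAFreeEngine → TwoTorsionDictionary → TraceDefectPayoff → OffClassResidual →
Summit.ABC.Harvest.SubexponentialSzpiro` is literally the planner's deciding theorem `closes` of
the route file (pure logic: `h₄ (h₃ h₁ h₂)`). Cell `abc-harv`, seat pr-4.

HONESTY. Content-free bookkeeping. The mathematical content of the line is
`TraceDefectSubexpSzpiro` (stmt-ABC-23394, closed by `traceDefectSubexpSzpiro_proof`); the last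
hypothesis `OffClassResidual` is the DECLARED residual of rung strength (A1′ off the class), not
claimed. Landing this implication proves nothing about abc, A-PS or the rung A1′
(`SubexponentialSzpiro`); it moves no rung of LADDER-ABC.
-/

-- `Summit.<Summit>.<Problem>` is the mandated summit-side namespace (CONVENTIONS §2); for the
-- single-conjunct summit `ABC` the two coincide, so the duplicate `ABC.ABC` is deliberate.
set_option linter.dupNamespace false

namespace Summit.ABC.ABC.Theorems

/-- **Closes stmt-ABC-23399** (item `Assembly` of route `AntisymmetricTwoTorsion`):
`RadAFreeEngine → TwoTorsionDictionary → TraceDefectPayoff → OffClassResidual →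
SubexponentialSzpiro`, by the route's own `closes` (pure logic). Content-free; NOT abc, NOT A-PS,
NOT A1′ — the residual hypothesis is declared, not discharged. [folklore] -/
theorem antisymmetricTwoTorsion_assembly_proof :
    Summit.ABC.ABC.Theses.AntisymmetricTwoTorsion.Assembly :=
  fun h₁ h₂ h₃ h₄ => Summit.ABC.ABC.Theses.AntisymmetricTwoTorsion.closes h₁ h₂ h₃ h₄

end Summit.ABC.ABC.Theorems
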